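import Summits.QuantumFields.YangMills.Theorems.FluctuationComparisonRegPrIntLS2BetaChartContChainCharts
import HarnessLib

/-!
# CHART∞ · III (LINE g18-1 `semiclassical_s2beta`, organ S2β, LAPLACE row): the fibred chart of `Ū⁽ⁿ⁾` is JOINTLY continuous on the guarded closed chain set

R3 = Balaban's UV-stability programme on the finite 3-torus, gauge group `SU(N)` (generic `(P, N)` here) — NOT d = 4, NOT infinite volume, NOT a mass gap,
NOT Clay; the Yang–Mills gap is NOT proved by anything in this file.  Helper toward crux `stmt-QuantumFields-20520` (`FluctuationComparisonRegPrIntL`),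
LINE g18-1, LAPLACE row, letter CHART∞ (C1′).

★★★`exists_fibredChart_iter_cont` = ✓`exists_fibredChart_iter_reg` (F2 `…WregFibredChartReg`) VERBATIM — same chart
`Φ (V, z) = extend (iterCentralBond n) (c ↦ ϑ c z (V c)) z`, same Jacobian `Jac = 𝟙{∀ c, V c ∈ T c z} · ∏_c jd c z (V c)`, same thirteen conjuncts — built
on Part II's ✓`exists_chainCharts_cont` instead of ✓`exists_chainCharts_lb`, with two more conjuncts: `Φ` and `Jac` are (jointly) continuous on the guarded
closed chain set `{(V, z) | every loop variable of Ū⁽ᵏ⁾(z), k < n, is ≤ α ∧ ∀ c, V c ∈ T c z}`.  In particular, for a FIXED coarse field `V`, the fibre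
amplitude `z ↦ Jac (V, z)` and the chart `z ↦ Φ (V, z)` are continuous on `{z | small history ∧ ∀ c, V c ∈ T c z}`, and at points of STRICT small history
(`< α`; ★`isOpen_loopSmallSet_lt`: an open set) continuous WITHIN the pivot-blind window graph `{(V, z) | ∀ c, V c ∈ T c z}` (last conjunct) — the «continuous version of
`(Φ(V,·), jac(V,·))` on the closed iterated central-window chain» that the LAPLACE row's LIMIT door consumes (its `a`-continuity rows), pivot-blind by
✓`extend`. [cite: Balaban1987RG1, (0.4) p.253, (2.4) p.266 and (2.10) p.267]
-/

noncomputable section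

open MeasureTheory Filter Topology Set
open scoped ENNReal NNReal
open Literature.MathematicalPhysics.QuantumFieldTheory.Balaban1983to89
open Literature.MathematicalPhysics.QuantumFieldTheory.Balaban1983to89.T4Continuum

namespace Summit.QuantumFields.YangMills.Theorems.FluctuationComparisonRegPrIntLS2BetaChartContFibredChart

open Summit.QuantumFields.YangMills.Theorems.FluctuationComparisonRegPrIntLWregChain
open Summit.QuantumFields.YangMills.Theorems.FluctuationComparisonRegPrIntLWregFibredChart
open Summit.QuantumFields.YangMills.Theorems.FluctuationComparisonRegPrIntLS2BetaChartContChainCharts (exists_chainCharts_cont)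
open Summit.QuantumFields.YangMills.Theorems.FluctuationComparisonRegPrIntLWregChartCharge (continuousAt_iter_of_loopSmall)
open Function
open Literature.MathematicalPhysics.QuantumFieldTheory.Balaban1983to89.BlockAveraging (Idx avgFun measurable_avgFun loopHol)
open Literature.MathematicalPhysics.QuantumFieldTheory.Balaban1983to89.BlockAveragingHaarAC (centralBond centralBond_injective isLocal_avgFun pre post)
open Literature.MathematicalPhysics.QuantumFieldTheory.Balaban1983to89.BlockAveragingEMLHaarAC (fibreFamily offCard)
open Literature.MathematicalPhysics.QuantumFieldTheory.Balaban1983to89.ExpMeanLog (expMeanLogSU deltaSU deltaSU_pos measurable_expMeanLogSU_E)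
open Literature.MathematicalPhysics.QuantumFieldTheory.Balaban1983to89.Node00 (SU)

variable {P : Params} {N : ℕ} [NeZero N]

/-- ★ **THE STRICT SMALL-HISTORY SET IS OPEN**: `{U | ∀ k < n, every loop variable of Ū⁽ᵏ⁾(U) is < α}` is open for `α < δ_N` — at a point of the set `Ū⁽ᵏ⁾` is
continuous (✓`continuousAt_iter_of_loopSmall`, from the non-strict inequalities), so each of the finitely many strict conditions holds on a neighbourhood.
[cite: Balaban1987RG1, (0.4) p.253 (bookkeeping)] -/
theorem isOpen_loopSmallSet_lt {α : ℝ} (hαδ : α < deltaSU (Fin N)) : ∀ n : ℕ,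
    IsOpen {U : GaugeField P 0 (SU N) | ∀ k, k < n → ∀ (c' : PBond P (k + 1)) (i : Idx P),
      dist1 (loopHol (Averaging.iter (fun i => BlockAveraging.blockAvg (P := P) (j := i) (expMeanLogSU (n := Fin N))) k U) c' i) < α}
  | 0 => by
      have h : {U : GaugeField P 0 (SU N) | ∀ k, k < 0 → ∀ (c' : PBond P (k + 1)) (i : Idx P),
          dist1 (loopHol (Averaging.iter (fun i => BlockAveraging.blockAvg (P := P) (j := i) (expMeanLogSU (n := Fin N))) k U) c' i) < α} = univ :=
        eq_univ_of_forall fun U k hk => absurd hk (Nat.not_lt_zero k)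
      rw [h]; exact isOpen_univ
  | n + 1 => by
      have IH := isOpen_loopSmallSet_lt hαδ n
      refine isOpen_iff_mem_nhds.2 fun U₀ hU₀ => ?_
      have hU₀n : U₀ ∈ {U : GaugeField P 0 (SU N) | ∀ k, k < n → ∀ (c' : PBond P (k + 1)) (i : Idx P),
          dist1 (loopHol (Averaging.iter (fun i => BlockAveraging.blockAvg (P := P) (j := i) (expMeanLogSU (n := Fin N))) k U) c' i) < α} :=
        fun k hk => hU₀ k (by omega)
      have hA := continuousAt_iter_of_loopSmall (P := P) (N := N) hαδ (n := n) U₀ fun k hk c' i => (hU₀ k (by omega) c' i).le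
      have hn : ∀ᶠ U in 𝓝 U₀, ∀ (c' : PBond P (n + 1)) (i : Idx P),
          dist1 (loopHol (Averaging.iter (fun i => BlockAveraging.blockAvg (P := P) (j := i) (expMeanLogSU (n := Fin N))) n U) c' i) < α := by
        refine Filter.eventually_all.2 fun c' => Filter.eventually_all.2 fun i => ?_
        have hf : ContinuousAt (fun U : GaugeField P 0 (SU N) =>
            dist1 (loopHol (Averaging.iter (fun i => BlockAveraging.blockAvg (P := P) (j := i) (expMeanLogSU (n := Fin N))) n U) c' i)) U₀ :=
          ((B12ContinuousTransportInvarianceOn.continuous_dist1_SU (N := N)).comp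
            ((continuous_apply i).comp (BlockAveraging.continuous_loopHol (n := Fin N) c'))).continuousAt.comp hA
        exact hf.eventually (gt_mem_nhds (hU₀ n (lt_add_one n) c' i))
      filter_upwards [IH.mem_nhds hU₀n, hn] with U hU hUn
      intro k hk c' i
      rcases Nat.lt_succ_iff_lt_or_eq.1 hk with hkn | rfl
      · exact hU k hkn c' i
      · exact hUn c' i

/-- At a point of STRICT small history the non-strict small-history set is a neighbourhood. [cite: Balaban1987RG1, (0.4) p.253 (bookkeeping)] -/
theorem loopSmallSet_mem_nhds_of_lt {α : ℝ} (hαδ : α < deltaSU (Fin N)) (n : ℕ) {U₀ : GaugeField P 0 (SU N)}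
    (hU₀ : ∀ k, k < n → ∀ (c' : PBond P (k + 1)) (i : Idx P),
      dist1 (loopHol (Averaging.iter (fun i => BlockAveraging.blockAvg (P := P) (j := i) (expMeanLogSU (n := Fin N))) k U₀) c' i) < α) :
    {U : GaugeField P 0 (SU N) | ∀ k, k < n → ∀ (c' : PBond P (k + 1)) (i : Idx P),
      dist1 (loopHol (Averaging.iter (fun i => BlockAveraging.blockAvg (P := P) (j := i) (expMeanLogSU (n := Fin N))) k U) c' i) ≤ α} ∈ 𝓝 U₀ :=
  Filter.mem_of_superset ((isOpen_loopSmallSet_lt (P := P) (N := N) hαδ n).mem_nhds hU₀) fun _ hU k hk c' i => (hU k hk c' i).le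

/-- ★★★ **CHART-ALG III + CHART-REG + CHART∞**: the fibred chart of the iterated averaging with its image windows (✓`exists_fibredChart_iter_reg` verbatim) AND
joint continuity of the chart and of its Jacobian on the guarded closed chain set `{(V, z) | small loop history of z below level n ∧ ∀ c, V c ∈ T c z}`
(Part II ✓`exists_chainCharts_cont` coordinate by coordinate through ✓`extend`; the Jacobian is the finite product of the `jd c z (V c)` there).
[cite: Balaban1987RG1, (0.4) p.253, (2.4) p.266 and (2.10) p.267] -/
theorem exists_fibredChart_iter_cont {α : ℝ} (hα0 : 0 ≤ α) (hα24 : α ≤ 1 / 24) (hα64 : 64 * α ≤ deltaSU (Fin N))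
    (hαL : 157 * α < ((P.L : ℝ) ^ (P.d - 1))⁻¹)
    (hgap : ∀ j (c : PBond P (j + 1)), (offCard c : ℝ) / (Fintype.card (Idx P) : ℝ) + 150 * α < 1)
    {j₀ : ℝ≥0} (hvol : j₀ = 0 ∨ ChainVol P N α j₀) {n : ℕ} (hn : n ≤ P.m + P.K) :
    ∃ (Φ : GaugeField P n (SU N) × GaugeField P 0 (SU N) → GaugeField P 0 (SU N)) (Jac : GaugeField P n (SU N) × GaugeField P 0 (SU N) → ℝ≥0)
      (T : PBond P n → GaugeField P 0 (SU N) → Set (SU N)),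
      Measurable Φ ∧ Measurable Jac ∧
      (∀ V z, Jac (V, z) ≠ 0 → Averaging.iter (fun i => BlockAveraging.blockAvg (P := P) (j := i) (expMeanLogSU (n := Fin N))) n (Φ (V, z)) = V) ∧
      (∀ U₀ : Set (GaugeField P n (SU N)), MeasurableSet U₀ →
        (fieldMeasure P 0 (SU N)).restrict
            (Averaging.iter (fun i => BlockAveraging.blockAvg (P := P) (j := i) (expMeanLogSU (n := Fin N))) n ⁻¹' U₀ ∩
              {U | ∀ c, U (iterCentralBond n c) ∈ chainWindow α n U c}) =
          ((((fieldMeasure P n (SU N)).restrict U₀).prod (fieldMeasure P 0 (SU N))).withDensity fun p => (Jac p : ℝ≥0∞)).map Φ) ∧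
      (∀ c z, IsClosed (T c z)) ∧
      (∀ V z, Jac (V, z) ≠ 0 ↔ ∀ c, V c ∈ T c z) ∧
      (∀ V₀ z, (∀ c, V₀ c ∈ interior (T c z)) → ContinuousAt (fun V => Φ (V, z)) V₀ ∧ ContinuousAt (fun V => Jac (V, z)) V₀) ∧
      (∀ V₀ z, (∃ c, V₀ c ∉ closure (T c z)) → ∀ᶠ V in 𝓝 V₀, Jac (V, z) = 0) ∧
      (∀ c z, T c z = chainMap (expMeanLogSU (n := Fin N)) n z c '' chainWindow α n z c) ∧
      (∀ V z, (∀ c, V c ∈ T c z) → (∀ b, (∀ c, iterCentralBond n c ≠ b) → Φ (V, z) b = z b) ∧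
        ∀ c, Φ (V, z) (iterCentralBond n c) ∈ chainWindow α n (Φ (V, z)) c) ∧
      (∀ p, j₀ ^ (n * Fintype.card (PBond P n)) * Jac p ≤ 1) ∧
      (∀ V z (g : PBond P n → SU N), (∀ c, g c ∈ chainWindow α n z c) →
        (∀ c, V c = Averaging.iter (fun i => BlockAveraging.blockAvg (P := P) (j := i) (expMeanLogSU (n := Fin N))) n
          (extend (iterCentralBond n) g z) c) →
        Jac (V, z) ≠ 0 ∧ Φ (V, z) = extend (iterCentralBond n) g z) ∧
      ContinuousOn Φ {p : GaugeField P n (SU N) × GaugeField P 0 (SU N) |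
        (∀ k, k < n → ∀ (c' : PBond P (k + 1)) (i : Idx P),
          dist1 (loopHol (Averaging.iter (fun i => BlockAveraging.blockAvg (P := P) (j := i) (expMeanLogSU (n := Fin N))) k p.2) c' i) ≤ α) ∧
        ∀ c, p.1 c ∈ T c p.2} ∧
      ContinuousOn Jac {p : GaugeField P n (SU N) × GaugeField P 0 (SU N) |
        (∀ k, k < n → ∀ (c' : PBond P (k + 1)) (i : Idx P),
          dist1 (loopHol (Averaging.iter (fun i => BlockAveraging.blockAvg (P := P) (j := i) (expMeanLogSU (n := Fin N))) k p.2) c' i) ≤ α) ∧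
        ∀ c, p.1 c ∈ T c p.2} ∧
      (∀ (V : GaugeField P n (SU N)) (z₀ : GaugeField P 0 (SU N)),
        (∀ k, k < n → ∀ (c' : PBond P (k + 1)) (i : Idx P),
          dist1 (loopHol (Averaging.iter (fun i => BlockAveraging.blockAvg (P := P) (j := i) (expMeanLogSU (n := Fin N))) k z₀) c' i) < α) →
        (∀ c, V c ∈ T c z₀) →
        ContinuousWithinAt Φ {p : GaugeField P n (SU N) × GaugeField P 0 (SU N) | ∀ c, p.1 c ∈ T c p.2} (V, z₀) ∧
        ContinuousWithinAt Jac {p : GaugeField P n (SU N) × GaugeField P 0 (SU N) | ∀ c, p.1 c ∈ T c p.2} (V, z₀)) := by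
  have hαδ : α < deltaSU (Fin N) := by nlinarith [deltaSU_pos (n := Fin N)]
  obtain ⟨T, ϑ, jd, hTm, hθm, hjm, hright, hlaw, hTeq, hleft, hmemW, hTc, hθc, hjc, hj0, hjlb, hθg, hjdg⟩ :=
    exists_chainCharts_cont (N := N) (P := P) hα0 hα24 hα64 hαL hgap hvol hn
  have hA := isLocal_iter_blockAvg (P := P) (expMeanLogSU (n := Fin N)) hn
  have hβ := iterCentralBond_injective (P := P) (n := n) hn
  have hAm : Measurable (Averaging.iter (fun i => BlockAveraging.blockAvg (P := P) (j := i) (expMeanLogSU (n := Fin N))) n) :=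
    T4Continuum.measurable_iter _ (fun j => by rw [BlockAveraging.blockAvg_avg]; exact measurable_avgFun _ measurable_expMeanLogSU_E) n
  have hright' : ∀ c U, ∀ v ∈ T c U,
      Averaging.iter (fun i => BlockAveraging.blockAvg (P := P) (j := i) (expMeanLogSU (n := Fin N))) n (update U (iterCentralBond n c) (ϑ c U v)) c = v :=
    fun c U v hv => hright c U v hv
  refine ⟨fun p => extend (iterCentralBond n) (fun c => ϑ c p.2 (p.1 c)) p.2,
    fun p => {p : GaugeField P n (SU N) × GaugeField P 0 (SU N) | ∀ c, p.1 c ∈ T c p.2}.indicator (fun p => ∏ c, jd c p.2 (p.1 c)) p, T,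
    T4TriangularFibredChart.measurable_triChart ϑ hβ hθm, T4TriangularFibredChart.measurable_triJacobian T jd hTm hjm,
    fun V z hJ => T4TriangularFibredChart.apply_triChart_eq_of_jacobian_ne_zero T ϑ jd hA hβ hright' hJ, fun U₀ hU₀ => ?_, hTc,
    fun V z => ?_, fun V₀ z hint => ?_, fun V₀ z hout => ?_, hTeq, fun V z hV => ?charted, fun p => ?bdd, fun V z g hg hVg => ?recog, ?contAll⟩
  case contAll =>
    have hΦc : ContinuousOn (fun p : GaugeField P n (SU N) × GaugeField P 0 (SU N) => extend (iterCentralBond n) (fun c => ϑ c p.2 (p.1 c)) p.2)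
        {p : GaugeField P n (SU N) × GaugeField P 0 (SU N) |
          (∀ k, k < n → ∀ (c' : PBond P (k + 1)) (i : Idx P),
            dist1 (loopHol (Averaging.iter (fun i => BlockAveraging.blockAvg (P := P) (j := i) (expMeanLogSU (n := Fin N))) k p.2) c' i) ≤ α) ∧
          ∀ c, p.1 c ∈ T c p.2} := continuousOn_pi.2 fun b => by
      by_cases hb : ∃ c, iterCentralBond n c = b
      · obtain ⟨c, rfl⟩ := hb
        have h1 : (fun p : GaugeField P n (SU N) × GaugeField P 0 (SU N) => extend (iterCentralBond n) (fun c => ϑ c p.2 (p.1 c)) p.2 (iterCentralBond n c)) =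
            fun p => ϑ c p.2 (p.1 c) := funext fun p => hβ.extend_apply _ _ _
        rw [h1]
        have hι : Continuous fun p : GaugeField P n (SU N) × GaugeField P 0 (SU N) => ((p.2, p.1 c) : GaugeField P 0 (SU N) × SU N) :=
          continuous_snd.prodMk ((continuous_apply c).comp continuous_fst)
        exact (hθg c).comp hι.continuousOn fun p hp => ⟨hp.1, hp.2 c⟩
      · have h1 : (fun p : GaugeField P n (SU N) × GaugeField P 0 (SU N) => extend (iterCentralBond n) (fun c => ϑ c p.2 (p.1 c)) p.2 b) =
            fun p => p.2 b := funext fun p => extend_apply' _ _ _ hb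
        rw [h1]
        exact ((continuous_apply b).comp continuous_snd).continuousOn
    have hJc : ContinuousOn (fun p : GaugeField P n (SU N) × GaugeField P 0 (SU N) =>
        {p : GaugeField P n (SU N) × GaugeField P 0 (SU N) | ∀ c, p.1 c ∈ T c p.2}.indicator (fun p => ∏ c, jd c p.2 (p.1 c)) p)
        {p : GaugeField P n (SU N) × GaugeField P 0 (SU N) |
          (∀ k, k < n → ∀ (c' : PBond P (k + 1)) (i : Idx P),
            dist1 (loopHol (Averaging.iter (fun i => BlockAveraging.blockAvg (P := P) (j := i) (expMeanLogSU (n := Fin N))) k p.2) c' i) ≤ α) ∧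
          ∀ c, p.1 c ∈ T c p.2} := by
      have hprod : ContinuousOn (fun p : GaugeField P n (SU N) × GaugeField P 0 (SU N) => ∏ c, jd c p.2 (p.1 c))
          {p : GaugeField P n (SU N) × GaugeField P 0 (SU N) |
            (∀ k, k < n → ∀ (c' : PBond P (k + 1)) (i : Idx P),
              dist1 (loopHol (Averaging.iter (fun i => BlockAveraging.blockAvg (P := P) (j := i) (expMeanLogSU (n := Fin N))) k p.2) c' i) ≤ α) ∧
            ∀ c, p.1 c ∈ T c p.2} :=
        continuousOn_finsetProd _ fun c _ => by
          have hι : Continuous fun p : GaugeField P n (SU N) × GaugeField P 0 (SU N) => ((p.2, p.1 c) : GaugeField P 0 (SU N) × SU N) :=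
            continuous_snd.prodMk ((continuous_apply c).comp continuous_fst)
          exact (hjdg c).comp hι.continuousOn fun p hp => ⟨hp.1, hp.2 c⟩
      refine hprod.congr fun p hp => ?_
      have hps : p ∈ {p : GaugeField P n (SU N) × GaugeField P 0 (SU N) | ∀ c, p.1 c ∈ T c p.2} := hp.2
      exact Set.indicator_of_mem hps (fun p : GaugeField P n (SU N) × GaugeField P 0 (SU N) => ∏ c, jd c p.2 (p.1 c))
    refine ⟨hΦc, hJc, fun V z₀ hz₀ hV => ?_⟩
    have hmem : (V, z₀) ∈ {p : GaugeField P n (SU N) × GaugeField P 0 (SU N) |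
        (∀ k, k < n → ∀ (c' : PBond P (k + 1)) (i : Idx P),
          dist1 (loopHol (Averaging.iter (fun i => BlockAveraging.blockAvg (P := P) (j := i) (expMeanLogSU (n := Fin N))) k p.2) c' i) ≤ α) ∧
        ∀ c, p.1 c ∈ T c p.2} := ⟨fun k hk c' i => (hz₀ k hk c' i).le, hV⟩
    have hnhds : {p : GaugeField P n (SU N) × GaugeField P 0 (SU N) |
        (∀ k, k < n → ∀ (c' : PBond P (k + 1)) (i : Idx P),
          dist1 (loopHol (Averaging.iter (fun i => BlockAveraging.blockAvg (P := P) (j := i) (expMeanLogSU (n := Fin N))) k p.2) c' i) ≤ α) ∧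
        ∀ c, p.1 c ∈ T c p.2} ∈ 𝓝[{p : GaugeField P n (SU N) × GaugeField P 0 (SU N) | ∀ c, p.1 c ∈ T c p.2}] (V, z₀) := by
      have h1 := continuous_snd.continuousAt.preimage_mem_nhds
        (loopSmallSet_mem_nhds_of_lt (P := P) (N := N) hαδ n hz₀ :
          _ ∈ 𝓝 ((V, z₀) : GaugeField P n (SU N) × GaugeField P 0 (SU N)).2)
      filter_upwards [mem_nhdsWithin_of_mem_nhds h1, self_mem_nhdsWithin] with p hp hq
      exact ⟨hp, hq⟩
    exact ⟨(hΦc _ hmem).mono_of_mem_nhdsWithin hnhds, (hJc _ hmem).mono_of_mem_nhdsWithin hnhds⟩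
  case charted =>
    refine ⟨fun b hb => extend_apply' _ _ _ fun ⟨c, hc⟩ => hb c hc, fun c => ?_⟩
    dsimp only
    rw [hβ.extend_apply, chainWindow_extend α hn]
    exact hmemW c z _ (hV c)
  case recog =>
    have hVc : ∀ c, V c = chainMap (expMeanLogSU (n := Fin N)) n z c (g c) := fun c => by
      have hu : update (extend (iterCentralBond n) g z) (iterCentralBond n c) (g c) = extend (iterCentralBond n) g z := by
        rw [Function.update_eq_self_iff]
        exact (hβ.extend_apply g z c).symm
      rw [hVg c, ← chainMap_extend (expMeanLogSU (n := Fin N)) hn g z c]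
      simp only [chainMap, hu]
    have hlive : ∀ c, V c ∈ T c z := fun c => by
      rw [hTeq, hVc c]
      exact mem_image_of_mem _ (hg c)
    refine ⟨?_, ?_⟩
    · have hVs : (V, z) ∈ {p : GaugeField P n (SU N) × GaugeField P 0 (SU N) | ∀ c, p.1 c ∈ T c p.2} := hlive
      show {p : GaugeField P n (SU N) × GaugeField P 0 (SU N) | ∀ c, p.1 c ∈ T c p.2}.indicator (fun p => ∏ c, jd c p.2 (p.1 c)) (V, z) ≠ 0
      rw [Set.indicator_of_mem hVs]
      exact Finset.prod_ne_zero_iff.2 fun c _ => hj0 c z _ (hlive c)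
    · have hfun : (fun c => ϑ c z (V c)) = g := funext fun c => by rw [hVc c]; exact hleft c z (g c) (hg c)
      show extend (iterCentralBond n) (fun c => ϑ c z (V c)) z = extend (iterCentralBond n) g z
      rw [hfun]
  case bdd =>
    dsimp only
    by_cases hp : p ∈ {p : GaugeField P n (SU N) × GaugeField P 0 (SU N) | ∀ c, p.1 c ∈ T c p.2}
    · rw [Set.indicator_of_mem hp]
      calc j₀ ^ (n * Fintype.card (PBond P n)) * ∏ c, jd c p.2 (p.1 c) = ∏ c, j₀ ^ n * jd c p.2 (p.1 c) := by
            rw [Finset.prod_mul_distrib, Finset.prod_const, Finset.card_univ, ← pow_mul]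
        _ ≤ ∏ _c : PBond P n, (1 : ℝ≥0) := Finset.prod_le_prod' fun c _ => hjlb c p.2 _ (hp c)
        _ = 1 := Finset.prod_const_one
    · rw [Set.indicator_of_notMem hp, mul_zero]
      exact zero_le_one
  · exact T4TriangularFibredChart.pi_restrict_preimage_inter_eq_map_prod_withDensity (fun c U => chainWindow α n U c) T ϑ jd
      (HaarData.haar : Measure (SU N)) (HaarData.haar : Measure (SU N)) hA hβ hAm (measurableSet_chainWindow₂ α n) hTm hθm hjm
      (fun c U g => chainWindow_extend α hn g U c) hright' hlaw hU₀
  · -- `Jac ≠ 0 ↔ all coordinates in the windows`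
    dsimp only
    constructor
    · intro h
      by_contra hV
      have hVs : (V, z) ∉ {p : GaugeField P n (SU N) × GaugeField P 0 (SU N) | ∀ c, p.1 c ∈ T c p.2} := hV
      exact h (Set.indicator_of_notMem hVs _)
    · intro hV
      have hVs : (V, z) ∈ {p : GaugeField P n (SU N) × GaugeField P 0 (SU N) | ∀ c, p.1 c ∈ T c p.2} := hV
      rw [Set.indicator_of_mem hVs]
      exact Finset.prod_ne_zero_iff.2 fun c _ => hj0 c z _ (hV c)
  · -- continuity at an all-interior coarse point
    have hθat : ∀ c, ContinuousAt (fun V : GaugeField P n (SU N) => ϑ c z (V c)) V₀ := fun c =>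
      ContinuousAt.comp (f := fun V : GaugeField P n (SU N) => V c) (x := V₀)
        ((hθc c z).continuousAt (mem_interior_iff_mem_nhds.1 (hint c))) (continuous_apply c).continuousAt
    refine ⟨continuousAt_pi.2 fun b => ?_, ?_⟩
    · by_cases hb : ∃ c, iterCentralBond n c = b
      · obtain ⟨c, rfl⟩ := hb
        have h1 : (fun V : GaugeField P n (SU N) => extend (iterCentralBond n) (fun c => ϑ c z (V c)) z (iterCentralBond n c)) =
            fun V => ϑ c z (V c) := funext fun V => hβ.extend_apply _ _ _
        rw [h1]
        exact hθat c
      · have h1 : (fun V : GaugeField P n (SU N) => extend (iterCentralBond n) (fun c => ϑ c z (V c)) z b) = fun _ => z b :=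
          funext fun V => extend_apply' _ _ _ hb
        rw [h1]
        exact continuousAt_const
    · have hev : ∀ᶠ V in 𝓝 V₀, ∀ c, V c ∈ T c z :=
        Filter.eventually_all.2 fun c => (continuous_apply c).continuousAt.preimage_mem_nhds (mem_interior_iff_mem_nhds.1 (hint c))
      have hprod : ContinuousOn (fun V : GaugeField P n (SU N) => ∏ c, jd c z (V c)) {V | ∀ c, V c ∈ T c z} :=
        continuousOn_finsetProd _ fun c _ => (hjc c z).comp (continuous_apply c).continuousOn fun V hV => hV c
      have hat : ContinuousAt (fun V : GaugeField P n (SU N) => ∏ c, jd c z (V c)) V₀ :=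
        hprod.continuousAt (Filter.eventually_all.2 fun c =>
          (continuous_apply c).continuousAt.preimage_mem_nhds (mem_interior_iff_mem_nhds.1 (hint c)))
      refine hat.congr ?_
      filter_upwards [hev] with V hV
      have hVs : (V, z) ∈ {p : GaugeField P n (SU N) × GaugeField P 0 (SU N) | ∀ c, p.1 c ∈ T c p.2} := hV
      exact (Set.indicator_of_mem hVs (fun p : GaugeField P n (SU N) × GaugeField P 0 (SU N) => ∏ c, jd c p.2 (p.1 c))).symm
  · -- death near a coarse point with a coordinate outside the closure of its window
    obtain ⟨c, hc⟩ := hout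
    have hev : ∀ᶠ V in 𝓝 V₀, V c ∉ closure (T c z) :=
      (continuous_apply c).continuousAt.preimage_mem_nhds (isClosed_closure.isOpen_compl.mem_nhds hc)
    filter_upwards [hev] with V hV
    have hVs : (V, z) ∉ {p : GaugeField P n (SU N) × GaugeField P 0 (SU N) | ∀ c, p.1 c ∈ T c p.2} :=
      fun h => hV (subset_closure ((show ∀ c, V c ∈ T c z from h) c))
    exact Set.indicator_of_notMem hVs _


end Summit.QuantumFields.YangMills.Theorems.FluctuationComparisonRegPrIntLS2BetaChartContFibredChart

end
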